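import Summits.KontsevichZagierPeriods.KontsevichZagierPeriods.Theorems.UnfoldedStokesStokesGenerationStubSwapTransport
import Summits.KontsevichZagierPeriods.KontsevichZagierPeriods.Theorems.UnfoldedStokesStokesGenerationStubRungClampedAngularCertificateAux
import Mathlib.Analysis.Calculus.Deriv.Pow

/-!
# `StokesGeneration` (stmt-KontsevichZagierPeriods-3586) — line `fibrewise_stokes`, stub `stub_angTransport`

Registered stub V1 (rung 9, the angular-swap sector) of the line `fibrewise_stokes` of the crux
`StokesGeneration` (route UnfoldedStokes): **the closed-form transport, on the 4-cube `[0,1]⁴`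
(coordinates `x₀, x₁`, homotopy variable `y = x₂`, silent `x₃`), of the transposition of an angular
atom, `γ (ω_P(x₀) − ω_Q(x₁))`**, for the loops `P = A + iB`, `Q = E + iF` (real polynomials with
algebraic coefficients, `A, E > 0` on `[0,1]`), `ω_P = (A B′ − A′ B)/(A² + B²)`, `γ` real algebraic.
With `W = (1 − y) Q(x₁) + y P(x₀)` (`Re W > 0` on the cube, a convex combination of positives) the
closed form `d arg W = a₀ dx₀ + a₁ dx₁ + b dy` has `b = (B(x₀) E(x₁) − A(x₀) F(x₁))/|W|²` and
`a₀ + a₁ = ((y B′ + (1 − y) F′) Re W − (y A′ + (1 − y) E′) Im W)/|W|²`. Primitives, in the directions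
`![2, 0, 1]`: `G₀ = γ (y ω_P(x₀) + (1 − y) ω_Q(x₁) − (a₀ + a₁))` along `y` (BOTH boundary values
vanish: `W|_{y=1} = P(x₀)`, `W|_{y=0} = Q(x₁)`), and `G₁ = G₂ = γ b` along `x₀` and along `x₁` (fibre
derivatives `D₁ = γ ∂₀ b`, `D₂ = γ ∂₁ b`, quotient rule; boundary values the four displayed leftovers).
By closedness (`∂_y a₀ = ∂₀ b`, `∂_y a₁ = ∂₁ b`, an identity of rational functions checked by `ring`)
the fibre derivative of `G₀` is `D₀ = γ (ω_P − ω_Q) − (D₁ + D₂)`, whence `Σⱼ (Dⱼ − (Gⱼ|₁ − Gⱼ|₀))` is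
the relator minus the leftovers. All data are rational functions — denominators `|W|², A² + B²,
E² + F² > 0` on the cube — of the coordinates, of algebraic-coefficient polynomials read on one
coordinate and of real-algebraic constants: `ℚ`-semialgebraic (Bochnak–Coste–Roy, Prop. 2.2.6;
Kontsevich–Zagier §1.1) and continuous on the compact cube, hence bounded and integrable; no kink set.

References: M. Kontsevich, D. Zagier, *Periods* (2001), §1.1–1.2; J. Ayoub, *Une version relative de
la conjecture des périodes de Kontsevich–Zagier*, Ann. of Math. 181 (2015), Rem. 1.5; J. Bochnak,
M. Coste, M.-F. Roy, *Real Algebraic Geometry* (1998), Prop. 2.2.6.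
-/

noncomputable section

-- `Summit.KontsevichZagierPeriods.KontsevichZagierPeriods.…` is the tree's mandated layout (single-conjunct summit).
set_option linter.dupNamespace false

namespace Summit.KontsevichZagierPeriods.KontsevichZagierPeriods.Cruxes.StokesGeneration.FibrewiseStokes

open MeasureTheory Set
open Literature.NumberTheory.Transcendental
open Literature.NumberTheory.Transcendental.KZ
open Literature.ModelTheory.ExponentialFields (IsSemialgebraic)
open Polynomial (derivative)

/-! ## Semialgebraic-and-continuous functions (the regularity of all the transport data) -/

section SC

variable {m : ℕ} {S : Set (Fin m → ℝ)} {f g : (Fin m → ℝ) → ℝ}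

/-- Closure under pointwise sums. [cite: BochnakCosteRoy1998, Prop. 2.2.6] -/
theorem angTrSC_add (hf : IsSemialgebraicFunOn ℚ S f ∧ ContinuousOn f S)
    (hg : IsSemialgebraicFunOn ℚ S g ∧ ContinuousOn g S) :
    IsSemialgebraicFunOn ℚ S (fun x => f x + g x) ∧ ContinuousOn (fun x => f x + g x) S :=
  ⟨hf.1.fun_add hg.1, hf.2.add hg.2⟩

/-- Closure under pointwise differences. [cite: BochnakCosteRoy1998, Prop. 2.2.6] -/
theorem angTrSC_sub (hf : IsSemialgebraicFunOn ℚ S f ∧ ContinuousOn f S)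
    (hg : IsSemialgebraicFunOn ℚ S g ∧ ContinuousOn g S) :
    IsSemialgebraicFunOn ℚ S (fun x => f x - g x) ∧ ContinuousOn (fun x => f x - g x) S :=
  ⟨hf.1.fun_sub hg.1, hf.2.sub hg.2⟩

/-- Closure under pointwise products. [cite: BochnakCosteRoy1998, Prop. 2.2.6] -/
theorem angTrSC_mul (hf : IsSemialgebraicFunOn ℚ S f ∧ ContinuousOn f S)
    (hg : IsSemialgebraicFunOn ℚ S g ∧ ContinuousOn g S) :
    IsSemialgebraicFunOn ℚ S (fun x => f x * g x) ∧ ContinuousOn (fun x => f x * g x) S :=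
  ⟨hf.1.fun_mul hg.1, hf.2.mul hg.2⟩

/-- Closure under natural powers. [cite: BochnakCosteRoy1998, Prop. 2.2.6] -/
theorem angTrSC_pow (hf : IsSemialgebraicFunOn ℚ S f ∧ ContinuousOn f S) (n : ℕ) :
    IsSemialgebraicFunOn ℚ S (fun x => f x ^ n) ∧ ContinuousOn (fun x => f x ^ n) S :=
  ⟨hf.1.fun_pow n, hf.2.pow n⟩

/-- Closure under quotients, the denominator non-vanishing. [cite: BochnakCosteRoy1998, Prop. 2.2.6] -/
theorem angTrSC_div (hf : IsSemialgebraicFunOn ℚ S f ∧ ContinuousOn f S)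
    (hg : IsSemialgebraicFunOn ℚ S g ∧ ContinuousOn g S) (h0 : ∀ x ∈ S, g x ≠ 0) :
    IsSemialgebraicFunOn ℚ S (fun x => f x / g x) ∧ ContinuousOn (fun x => f x / g x) S :=
  ⟨hf.1.div hg.1 h0, hf.2.div hg.2 h0⟩

/-- Only the values on `S` matter. [folklore] -/
theorem angTrSC_congr (hf : IsSemialgebraicFunOn ℚ S f ∧ ContinuousOn f S) (h : EqOn f g S) :
    IsSemialgebraicFunOn ℚ S g ∧ ContinuousOn g S :=
  ⟨hf.1.congr h, hf.2.congr h.symm⟩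

/-- A continuous function on a compact set is bounded there. [folklore] -/
theorem angTrSC_bound (hf : IsSemialgebraicFunOn ℚ S f ∧ ContinuousOn f S) (hS : IsCompact S) :
    ∃ C : ℝ, ∀ x ∈ S, |f x| ≤ C := by
  obtain ⟨C, hC⟩ := hS.exists_bound_of_continuousOn hf.2
  exact ⟨C, fun x hx => by simpa only [Real.norm_eq_abs] using hC x hx⟩

/-- Real-algebraic constants are `ℚ`-semialgebraic (and continuous). [cite: KontsevichZagier2001, §1.1] -/
theorem angTrSC_const (hS : IsSemialgebraic ℚ S) {c : ℝ} (hc : IsAlgebraic ℚ c) :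
    IsSemialgebraicFunOn ℚ S (fun _ => c) ∧ ContinuousOn (fun _ => c) S :=
  ⟨isSemialgebraicFunOn_const_of_isAlgebraic hS hc, continuousOn_const⟩

/-- Coordinate functions are `ℚ`-semialgebraic and continuous. [cite: BochnakCosteRoy1998, §2.2] -/
theorem angTrSC_apply (hS : IsSemialgebraic ℚ S) (i : Fin m) :
    IsSemialgebraicFunOn ℚ S (fun x => x i) ∧ ContinuousOn (fun x => x i) S :=
  ⟨isSemialgebraicFunOn_apply hS i, (continuous_apply i).continuousOn⟩

/-- An algebraic-coefficient real polynomial read on one coordinate is `ℚ`-semialgebraic and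
continuous. [cite: BochnakCosteRoy1998, Prop. 2.2.6] -/
theorem angTrSC_eval (hS : IsSemialgebraic ℚ S) {q : Polynomial ℝ} (hq : ∀ n, IsAlgebraic ℚ (q.coeff n))
    (i : Fin m) : IsSemialgebraicFunOn ℚ S (fun x => q.eval (x i)) ∧ ContinuousOn (fun x => q.eval (x i)) S :=
  ⟨isSemialgebraicFunOn_eval_apply hS hq i, (q.continuous.comp (continuous_apply i)).continuousOn⟩

/-- `a² + b² ≠ 0` as soon as `a > 0`. [folklore] -/
theorem angTr_sq_add_sq_ne_zero {a : ℝ} (b : ℝ) (ha : 0 < a) : a ^ 2 + b ^ 2 ≠ 0 := by positivity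

end SC

/-! ## The transport -/

/-- **Registered stub `stub_angTransport` (rung 9, V1): closed-form transport of the angular-swap
relator on the 4-cube.** For real polynomials `A, B, E, F` with algebraic coefficients, `A, E > 0` on
`[0,1]`, and real algebraic `γ`, the relator `γ (ω_P(x₀) − ω_Q(x₁))` (`P = A + iB`, `Q = E + iF`)
equals, on `[0,1]⁴`, the sum of three fibrewise Stokes elements `Dⱼ − (Gⱼ|₁ − Gⱼ|₀)` in the
directions `![2, 0, 1]` (`G₀ = γ (y ω_P + (1 − y) ω_Q − (a₀ + a₁))`, `G₁ = G₂ = γ b`, where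
`d arg((1 − y) Q(x₁) + y P(x₀)) = a₀ dx₀ + a₁ dx₁ + b dy`, `y = x₂`), minus the four boundary leftovers
of `G₁, G₂`; all data `ℚ`-semialgebraic, continuous on the closed cube, no kink set.
[cite: Ayoub2015, Rem. 1.5] -/
theorem stub_angTransport :
    ∀ (γ : ℝ) (A B E F : Polynomial ℝ), IsAlgebraic ℚ γ → (∀ n, IsAlgebraic ℚ (A.coeff n)) →
      (∀ n, IsAlgebraic ℚ (B.coeff n)) → (∀ n, IsAlgebraic ℚ (E.coeff n)) → (∀ n, IsAlgebraic ℚ (F.coeff n)) →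
      (∀ u ∈ Set.Icc (0:ℝ) 1, 0 < A.eval u) → (∀ u ∈ Set.Icc (0:ℝ) 1, 0 < E.eval u) →
      ∃ (G D : Fin 3 → (Fin 4 → ℝ) → ℝ) (r : Fin 3 → IntegralRep 4),
        (∀ j, IsSemialgebraicFunOn ℚ (Set.pi Set.univ (fun _ : Fin 4 => Set.Icc (0:ℝ) 1)) (G j) ∧
          IsSemialgebraicFunOn ℚ (Set.pi Set.univ (fun _ : Fin 4 => Set.Icc (0:ℝ) 1)) (D j) ∧
          (∃ Bd : ℝ, ∀ x ∈ (Set.pi Set.univ (fun _ : Fin 4 => Set.Icc (0:ℝ) 1)), |(G j) x| ≤ Bd) ∧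
          (∀ x ∈ (Set.pi Set.univ (fun _ : Fin 4 => Set.Icc (0:ℝ) 1)),
            ContinuousOn (fun s : ℝ => (G j) (Function.update x ((![2, 0, 1] : Fin 3 → Fin 4) j) s)) (Set.Icc (0:ℝ) 1)) ∧
          (∀ x ∈ (Set.pi Set.univ (fun _ : Fin 4 => Set.Icc (0:ℝ) 1)), x ((![2, 0, 1] : Fin 3 → Fin 4) j) ∈ Set.Ioo (0:ℝ) 1 →
            HasDerivAt (fun s : ℝ => (G j) (Function.update x ((![2, 0, 1] : Fin 3 → Fin 4) j) s)) ((D j) x)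
              (x ((![2, 0, 1] : Fin 3 → Fin 4) j)))) ∧
        (∀ j, (r j).domain = (Set.pi Set.univ (fun _ : Fin 4 => Set.Icc (0:ℝ) 1)) ∧
          ∀ x ∈ (Set.pi Set.univ (fun _ : Fin 4 => Set.Icc (0:ℝ) 1)), (r j).integrand x =
            D j x - (G j (Function.update x ((![2, 0, 1] : Fin 3 → Fin 4) j) 1) -
              G j (Function.update x ((![2, 0, 1] : Fin 3 → Fin 4) j) 0))) ∧
        ∀ x ∈ (Set.pi Set.univ (fun _ : Fin 4 => Set.Icc (0:ℝ) 1)), ∑ j, (r j).integrand x =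
          γ * ((A.eval (x 0) * (Polynomial.derivative B).eval (x 0) - (Polynomial.derivative A).eval (x 0) * B.eval (x 0)) /
                  (A.eval (x 0) ^ 2 + B.eval (x 0) ^ 2) -
                (E.eval (x 1) * (Polynomial.derivative F).eval (x 1) - (Polynomial.derivative E).eval (x 1) * F.eval (x 1)) /
                  (E.eval (x 1) ^ 2 + F.eval (x 1) ^ 2)) -
          γ * ((B.eval 1 * E.eval (x 1) - A.eval 1 * F.eval (x 1)) /
                  (((1 - x 2) * E.eval (x 1) + x 2 * A.eval 1) ^ 2 + ((1 - x 2) * F.eval (x 1) + x 2 * B.eval 1) ^ 2) -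
                (B.eval 0 * E.eval (x 1) - A.eval 0 * F.eval (x 1)) /
                  (((1 - x 2) * E.eval (x 1) + x 2 * A.eval 0) ^ 2 + ((1 - x 2) * F.eval (x 1) + x 2 * B.eval 0) ^ 2)) -
          γ * ((B.eval (x 0) * E.eval 1 - A.eval (x 0) * F.eval 1) /
                  (((1 - x 2) * E.eval 1 + x 2 * A.eval (x 0)) ^ 2 + ((1 - x 2) * F.eval 1 + x 2 * B.eval (x 0)) ^ 2) -
                (B.eval (x 0) * E.eval 0 - A.eval (x 0) * F.eval 0) /
                  (((1 - x 2) * E.eval 0 + x 2 * A.eval (x 0)) ^ 2 + ((1 - x 2) * F.eval 0 + x 2 * B.eval (x 0)) ^ 2)) := by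
  intro γ A B E F hγ hA hB hE hF hApos hEpos
  -- the closed 4-cube and what holds on it
  set S : Set (Fin 4 → ℝ) := Set.pi Set.univ (fun _ : Fin 4 => Set.Icc (0:ℝ) 1) with hS
  have hSsa : IsSemialgebraic ℚ S := by rw [hS, ← cube_eq_pi]; exact isSemialgebraic_cube
  have hSc : IsCompact S := isCompact_univ_pi fun _ => isCompact_Icc
  have hmem : ∀ x ∈ S, ∀ i, x i ∈ Set.Icc (0:ℝ) 1 := fun x hx i => (Set.mem_univ_pi.mp hx) i
  have h0I : (0:ℝ) ∈ Set.Icc (0:ℝ) 1 := ⟨le_rfl, zero_le_one⟩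
  have h1I : (1:ℝ) ∈ Set.Icc (0:ℝ) 1 := ⟨zero_le_one, le_rfl⟩
  have h02 : (0 : Fin 4) ≠ 2 ∧ (1 : Fin 4) ≠ 2 := by decide
  have h10 : (1 : Fin 4) ≠ 0 ∧ (2 : Fin 4) ≠ 0 := by decide
  have h01 : (0 : Fin 4) ≠ 1 ∧ (2 : Fin 4) ≠ 1 := by decide
  have hupd : ∀ x ∈ S, ∀ (i : Fin 4), ∀ s ∈ Set.Icc (0:ℝ) 1, Function.update x i s ∈ S := by
    intro x hx i s hs
    refine Set.mem_univ_pi.mpr fun l => ?_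
    rcases eq_or_ne l i with rfl | hli
    · simpa using hs
    · rw [Function.update_of_ne hli]
      exact hmem x hx l
  -- positivity: `Re W = (1 - y) E(v) + y A(u) > 0`, hence `|W|² ≠ 0`; `A² + B², E² + F² ≠ 0`
  have hWne : ∀ u ∈ Set.Icc (0:ℝ) 1, ∀ v ∈ Set.Icc (0:ℝ) 1, ∀ x ∈ S, ∀ p q : ℝ,
      ((1 - x 2) * E.eval v + x 2 * A.eval u) ^ 2 + ((1 - x 2) * q + x 2 * p) ^ 2 ≠ 0 :=
    fun u hu v hv x hx p q =>
      angTr_sq_add_sq_ne_zero _ (swapTr_combo_pos (hApos u hu) (hEpos v hv) (hmem x hx 2))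
  have hNne : ∀ x ∈ S, ((1 - x 2) * E.eval (x 1) + x 2 * A.eval (x 0)) ^ 2 +
      ((1 - x 2) * F.eval (x 1) + x 2 * B.eval (x 0)) ^ 2 ≠ 0 := fun x hx =>
    hWne _ (hmem x hx 0) _ (hmem x hx 1) x hx _ _
  have hN2ne : ∀ x ∈ S, (((1 - x 2) * E.eval (x 1) + x 2 * A.eval (x 0)) ^ 2 +
      ((1 - x 2) * F.eval (x 1) + x 2 * B.eval (x 0)) ^ 2) ^ 2 ≠ 0 := fun x hx => pow_ne_zero 2 (hNne x hx)
  have hPne : ∀ x ∈ S, A.eval (x 0) ^ 2 + B.eval (x 0) ^ 2 ≠ 0 := fun x hx =>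
    angTr_sq_add_sq_ne_zero _ (hApos _ (hmem x hx 0))
  have hQne : ∀ x ∈ S, E.eval (x 1) ^ 2 + F.eval (x 1) ^ 2 ≠ 0 := fun x hx =>
    angTr_sq_add_sq_ne_zero _ (hEpos _ (hmem x hx 1))
  -- the witnesses: `G₀` (along `y`), `G₁ = G₂ = γ b` (along `x₀`, `x₁`), `D₁ = γ ∂₀ b`,
  -- `D₂ = γ ∂₁ b`, `D₀ = γ (ω_P − ω_Q) − (D₁ + D₂)`
  obtain ⟨G0, hG0⟩ : ∃ G0 : (Fin 4 → ℝ) → ℝ, G0 = fun x =>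
      γ * (x 2 * ((A.eval (x 0) * (derivative B).eval (x 0) - (derivative A).eval (x 0) * B.eval (x 0)) /
              (A.eval (x 0) ^ 2 + B.eval (x 0) ^ 2)) +
          (1 - x 2) * ((E.eval (x 1) * (derivative F).eval (x 1) - (derivative E).eval (x 1) * F.eval (x 1)) /
              (E.eval (x 1) ^ 2 + F.eval (x 1) ^ 2)) -
          ((x 2 * (derivative B).eval (x 0) + (1 - x 2) * (derivative F).eval (x 1)) *
                ((1 - x 2) * E.eval (x 1) + x 2 * A.eval (x 0)) -
              (x 2 * (derivative A).eval (x 0) + (1 - x 2) * (derivative E).eval (x 1)) *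
                ((1 - x 2) * F.eval (x 1) + x 2 * B.eval (x 0))) /
            (((1 - x 2) * E.eval (x 1) + x 2 * A.eval (x 0)) ^ 2 +
              ((1 - x 2) * F.eval (x 1) + x 2 * B.eval (x 0)) ^ 2)) := ⟨_, rfl⟩
  obtain ⟨G1, hG1⟩ : ∃ G1 : (Fin 4 → ℝ) → ℝ, G1 = fun x =>
      γ * (B.eval (x 0) * E.eval (x 1) - A.eval (x 0) * F.eval (x 1)) /
        (((1 - x 2) * E.eval (x 1) + x 2 * A.eval (x 0)) ^ 2 +
          ((1 - x 2) * F.eval (x 1) + x 2 * B.eval (x 0)) ^ 2) := ⟨_, rfl⟩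
  obtain ⟨D1, hD1⟩ : ∃ D1 : (Fin 4 → ℝ) → ℝ, D1 = fun x =>
      γ * (((derivative B).eval (x 0) * E.eval (x 1) - (derivative A).eval (x 0) * F.eval (x 1)) *
            (((1 - x 2) * E.eval (x 1) + x 2 * A.eval (x 0)) ^ 2 +
              ((1 - x 2) * F.eval (x 1) + x 2 * B.eval (x 0)) ^ 2) -
          (B.eval (x 0) * E.eval (x 1) - A.eval (x 0) * F.eval (x 1)) *
            (2 * ((1 - x 2) * E.eval (x 1) + x 2 * A.eval (x 0)) * (x 2 * (derivative A).eval (x 0)) +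
              2 * ((1 - x 2) * F.eval (x 1) + x 2 * B.eval (x 0)) * (x 2 * (derivative B).eval (x 0)))) /
        (((1 - x 2) * E.eval (x 1) + x 2 * A.eval (x 0)) ^ 2 +
          ((1 - x 2) * F.eval (x 1) + x 2 * B.eval (x 0)) ^ 2) ^ 2 := ⟨_, rfl⟩
  obtain ⟨D2, hD2⟩ : ∃ D2 : (Fin 4 → ℝ) → ℝ, D2 = fun x =>
      γ * ((B.eval (x 0) * (derivative E).eval (x 1) - A.eval (x 0) * (derivative F).eval (x 1)) *
            (((1 - x 2) * E.eval (x 1) + x 2 * A.eval (x 0)) ^ 2 +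
              ((1 - x 2) * F.eval (x 1) + x 2 * B.eval (x 0)) ^ 2) -
          (B.eval (x 0) * E.eval (x 1) - A.eval (x 0) * F.eval (x 1)) *
            (2 * ((1 - x 2) * E.eval (x 1) + x 2 * A.eval (x 0)) * ((1 - x 2) * (derivative E).eval (x 1)) +
              2 * ((1 - x 2) * F.eval (x 1) + x 2 * B.eval (x 0)) * ((1 - x 2) * (derivative F).eval (x 1)))) /
        (((1 - x 2) * E.eval (x 1) + x 2 * A.eval (x 0)) ^ 2 +
          ((1 - x 2) * F.eval (x 1) + x 2 * B.eval (x 0)) ^ 2) ^ 2 := ⟨_, rfl⟩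
  obtain ⟨D0, hD0⟩ : ∃ D0 : (Fin 4 → ℝ) → ℝ, D0 = fun x =>
      γ * ((A.eval (x 0) * (derivative B).eval (x 0) - (derivative A).eval (x 0) * B.eval (x 0)) /
              (A.eval (x 0) ^ 2 + B.eval (x 0) ^ 2) -
            (E.eval (x 1) * (derivative F).eval (x 1) - (derivative E).eval (x 1) * F.eval (x 1)) /
              (E.eval (x 1) ^ 2 + F.eval (x 1) ^ 2)) -
        (D1 x + D2 x) := ⟨_, rfl⟩
  -- both boundary values of `G₀` vanish (`W|_{y=1} = P(x₀)`, `W|_{y=0} = Q(x₁)`)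
  have hG0_one : ∀ x, G0 (Function.update x 2 1) = 0 := fun x => by
    simp only [hG0, Function.update_self, Function.update_of_ne h02.1, Function.update_of_ne h02.2]; ring
  have hG0_zero : ∀ x, G0 (Function.update x 2 0) = 0 := fun x => by
    simp only [hG0, Function.update_self, Function.update_of_ne h02.1, Function.update_of_ne h02.2]; ring
  -- atoms: semialgebraic and continuous on the cube
  have hy := angTrSC_apply hSsa 2
  have h1y := angTrSC_sub (angTrSC_const hSsa isAlgebraic_one) hy
  have hγ' := angTrSC_const hSsa hγ
  have h2 := angTrSC_const hSsa (isAlgebraic_nat 2 : IsAlgebraic ℚ ((2:ℕ):ℝ))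
  have hA0 := angTrSC_eval hSsa hA 0
  have hB0 := angTrSC_eval hSsa hB 0
  have hA'0 := angTrSC_eval hSsa (isAlgebraic_coeff_derivative hA) 0
  have hB'0 := angTrSC_eval hSsa (isAlgebraic_coeff_derivative hB) 0
  have hE1 := angTrSC_eval hSsa hE 1
  have hF1 := angTrSC_eval hSsa hF 1
  have hE'1 := angTrSC_eval hSsa (isAlgebraic_coeff_derivative hE) 1
  have hF'1 := angTrSC_eval hSsa (isAlgebraic_coeff_derivative hF) 1
  have hcst : ∀ {q : Polynomial ℝ}, (∀ n, IsAlgebraic ℚ (q.coeff n)) → ∀ c : ℝ, IsAlgebraic ℚ c →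
      IsSemialgebraicFunOn ℚ S (fun _ => q.eval c) ∧ ContinuousOn (fun _ => q.eval c) S :=
    fun hq c hc => angTrSC_const hSsa (rungClamp_isAlgebraic_eval _ hq hc)
  -- the angular atoms `ω_P(x₀)`, `ω_Q(x₁)`; `Re W`, `Im W`, `|W|²`
  have hωP := angTrSC_div (angTrSC_sub (angTrSC_mul hA0 hB'0) (angTrSC_mul hA'0 hB0))
    (angTrSC_add (angTrSC_pow hA0 2) (angTrSC_pow hB0 2)) hPne
  have hωQ := angTrSC_div (angTrSC_sub (angTrSC_mul hE1 hF'1) (angTrSC_mul hE'1 hF1))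
    (angTrSC_add (angTrSC_pow hE1 2) (angTrSC_pow hF1 2)) hQne
  have hR := angTrSC_add (angTrSC_mul h1y hE1) (angTrSC_mul hy hA0)
  have hI := angTrSC_add (angTrSC_mul h1y hF1) (angTrSC_mul hy hB0)
  have hN := angTrSC_add (angTrSC_pow hR 2) (angTrSC_pow hI 2)
  -- `γ b` with `A(x₀), B(x₀)` resp. `E(x₁), F(x₁)` replaced by arbitrary atoms (so as to cover the faces)
  have hbsc : ∀ {a b e f : (Fin 4 → ℝ) → ℝ},
      IsSemialgebraicFunOn ℚ S a ∧ ContinuousOn a S → IsSemialgebraicFunOn ℚ S b ∧ ContinuousOn b S →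
      IsSemialgebraicFunOn ℚ S e ∧ ContinuousOn e S → IsSemialgebraicFunOn ℚ S f ∧ ContinuousOn f S →
      (∀ x ∈ S, ((1 - x 2) * e x + x 2 * a x) ^ 2 + ((1 - x 2) * f x + x 2 * b x) ^ 2 ≠ 0) →
      IsSemialgebraicFunOn ℚ S (fun x => γ * (b x * e x - a x * f x) /
          (((1 - x 2) * e x + x 2 * a x) ^ 2 + ((1 - x 2) * f x + x 2 * b x) ^ 2)) ∧
        ContinuousOn (fun x => γ * (b x * e x - a x * f x) /
          (((1 - x 2) * e x + x 2 * a x) ^ 2 + ((1 - x 2) * f x + x 2 * b x) ^ 2)) S :=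
    fun ha hb he hf hne => angTrSC_div (angTrSC_mul hγ' (angTrSC_sub (angTrSC_mul hb he) (angTrSC_mul ha hf)))
      (angTrSC_add (angTrSC_pow (angTrSC_add (angTrSC_mul h1y he) (angTrSC_mul hy ha)) 2)
        (angTrSC_pow (angTrSC_add (angTrSC_mul h1y hf) (angTrSC_mul hy hb)) 2)) hne
  -- regularity of the witnesses (closure under field operations, BCR Prop. 2.2.6)
  have hG0sc : IsSemialgebraicFunOn ℚ S G0 ∧ ContinuousOn G0 S := by
    rw [hG0]
    exact angTrSC_mul hγ' (angTrSC_sub (angTrSC_add (angTrSC_mul hy hωP) (angTrSC_mul h1y hωQ))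
      (angTrSC_div (angTrSC_sub
        (angTrSC_mul (angTrSC_add (angTrSC_mul hy hB'0) (angTrSC_mul h1y hF'1)) hR)
        (angTrSC_mul (angTrSC_add (angTrSC_mul hy hA'0) (angTrSC_mul h1y hE'1)) hI)) hN hNne))
  have hG1sc : IsSemialgebraicFunOn ℚ S G1 ∧ ContinuousOn G1 S := by
    rw [hG1]
    exact hbsc hA0 hB0 hE1 hF1 hNne
  have hD1sc : IsSemialgebraicFunOn ℚ S D1 ∧ ContinuousOn D1 S := by
    rw [hD1]
    exact angTrSC_div (angTrSC_mul hγ' (angTrSC_sub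
      (angTrSC_mul (angTrSC_sub (angTrSC_mul hB'0 hE1) (angTrSC_mul hA'0 hF1)) hN)
      (angTrSC_mul (angTrSC_sub (angTrSC_mul hB0 hE1) (angTrSC_mul hA0 hF1))
        (angTrSC_add (angTrSC_mul (angTrSC_mul h2 hR) (angTrSC_mul hy hA'0))
          (angTrSC_mul (angTrSC_mul h2 hI) (angTrSC_mul hy hB'0)))))) (angTrSC_pow hN 2) hN2ne
  have hD2sc : IsSemialgebraicFunOn ℚ S D2 ∧ ContinuousOn D2 S := by
    rw [hD2]
    exact angTrSC_div (angTrSC_mul hγ' (angTrSC_sub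
      (angTrSC_mul (angTrSC_sub (angTrSC_mul hB0 hE'1) (angTrSC_mul hA0 hF'1)) hN)
      (angTrSC_mul (angTrSC_sub (angTrSC_mul hB0 hE1) (angTrSC_mul hA0 hF1))
        (angTrSC_add (angTrSC_mul (angTrSC_mul h2 hR) (angTrSC_mul h1y hE'1))
          (angTrSC_mul (angTrSC_mul h2 hI) (angTrSC_mul h1y hF'1)))))) (angTrSC_pow hN 2) hN2ne
  have hD0sc : IsSemialgebraicFunOn ℚ S D0 ∧ ContinuousOn D0 S := by
    rw [hD0]
    exact angTrSC_sub (angTrSC_mul hγ' (angTrSC_sub hωP hωQ)) (angTrSC_add hD1sc hD2sc)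
  have hI1sc : IsSemialgebraicFunOn ℚ S (fun x => D1 x - (G1 (Function.update x 0 1) - G1 (Function.update x 0 0))) ∧
      ContinuousOn (fun x => D1 x - (G1 (Function.update x 0 1) - G1 (Function.update x 0 0))) S := by
    refine angTrSC_congr (angTrSC_sub hD1sc (angTrSC_sub
      (hbsc (hcst hA 1 isAlgebraic_one) (hcst hB 1 isAlgebraic_one) hE1 hF1 fun x hx =>
        hWne 1 h1I _ (hmem x hx 1) x hx _ _)
      (hbsc (hcst hA 0 isAlgebraic_zero) (hcst hB 0 isAlgebraic_zero) hE1 hF1 fun x hx =>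
        hWne 0 h0I _ (hmem x hx 1) x hx _ _))) fun x _ => ?_
    simp only [hG1, Function.update_self, Function.update_of_ne h10.1, Function.update_of_ne h10.2]
  have hI2sc : IsSemialgebraicFunOn ℚ S (fun x => D2 x - (G1 (Function.update x 1 1) - G1 (Function.update x 1 0))) ∧
      ContinuousOn (fun x => D2 x - (G1 (Function.update x 1 1) - G1 (Function.update x 1 0))) S := by
    refine angTrSC_congr (angTrSC_sub hD2sc (angTrSC_sub
      (hbsc hA0 hB0 (hcst hE 1 isAlgebraic_one) (hcst hF 1 isAlgebraic_one) fun x hx =>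
        hWne _ (hmem x hx 0) 1 h1I x hx _ _)
      (hbsc hA0 hB0 (hcst hE 0 isAlgebraic_zero) (hcst hF 0 isAlgebraic_zero) fun x hx =>
        hWne _ (hmem x hx 0) 0 h0I x hx _ _))) fun x _ => ?_
    simp only [hG1, Function.update_self, Function.update_of_ne h01.1, Function.update_of_ne h01.2]
  -- packaged as `Fin 3`-families (`G₂ = G₁`); the integrands are `Dⱼ − (Gⱼ|₁ − Gⱼ|₀)`
  -- (`G₀|₁ = G₀|₀ = 0`)
  set G : Fin 3 → (Fin 4 → ℝ) → ℝ := ![G0, G1, G1]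
  set D : Fin 3 → (Fin 4 → ℝ) → ℝ := ![D0, D1, D2]
  set I : Fin 3 → (Fin 4 → ℝ) → ℝ :=
    ![D0, fun x => D1 x - (G1 (Function.update x 0 1) - G1 (Function.update x 0 0)),
      fun x => D2 x - (G1 (Function.update x 1 1) - G1 (Function.update x 1 0))]
  have hGsc : ∀ j, IsSemialgebraicFunOn ℚ S (G j) ∧ ContinuousOn (G j) S := fun j => by
    fin_cases j; exacts [hG0sc, hG1sc, hG1sc]
  have hDsa : ∀ j, IsSemialgebraicFunOn ℚ S (D j) := fun j => by
    fin_cases j; exacts [hD0sc.1, hD1sc.1, hD2sc.1]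
  have hIsc : ∀ j, IsSemialgebraicFunOn ℚ S (I j) ∧ ContinuousOn (I j) S := fun j => by
    fin_cases j; exacts [hD0sc, hI1sc, hI2sc]
  -- continuity along closed fibres
  have hGfib : ∀ j, ∀ x ∈ S, ContinuousOn
      (fun s : ℝ => G j (Function.update x ((![2, 0, 1] : Fin 3 → Fin 4) j) s)) (Set.Icc (0:ℝ) 1) := by
    intro j x hx
    have hc : Continuous fun s : ℝ => Function.update x ((![2, 0, 1] : Fin 3 → Fin 4) j) s :=
      continuous_const.update _ continuous_id
    exact (hGsc j).2.comp hc.continuousOn fun s hs => hupd x hx _ s hs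
  -- derivatives along the fibres: quotient rule, and for `G₀` the closedness relations
  -- `∂_y a₀ = ∂₀ b`, `∂_y a₁ = ∂₁ b` of `d arg W` (an identity of rational functions, `ring`)
  have hl : ∀ c d s : ℝ, HasDerivAt (fun u : ℝ => u * c + (1 - u) * d) (1 * c + (0 - 1) * d) s :=
    fun c d s => ((hasDerivAt_id' s).mul_const c).fun_add
      (((hasDerivAt_const s (1:ℝ)).fun_sub (hasDerivAt_id' s)).mul_const d)
  have hl' : ∀ c d s : ℝ, HasDerivAt (fun u : ℝ => (1 - u) * c + u * d) ((0 - 1) * c + 1 * d) s :=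
    fun c d s => (((hasDerivAt_const s (1:ℝ)).fun_sub (hasDerivAt_id' s)).mul_const c).fun_add
      ((hasDerivAt_id' s).mul_const d)
  have hGder : ∀ j, ∀ x ∈ S, x ((![2, 0, 1] : Fin 3 → Fin 4) j) ∈ Set.Ioo (0:ℝ) 1 →
      HasDerivAt (fun s : ℝ => G j (Function.update x ((![2, 0, 1] : Fin 3 → Fin 4) j) s)) (D j x)
        (x ((![2, 0, 1] : Fin 3 → Fin 4) j)) := by
    intro j
    fin_cases j <;> intro x hx _
    · show HasDerivAt (fun s : ℝ => G0 (Function.update x 2 s)) (D0 x) (x 2)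
      simp only [hG0, hD0, hD1, hD2, Function.update_self, Function.update_of_ne h02.1,
        Function.update_of_ne h02.2]
      have hRe := hl' (E.eval (x 1)) (A.eval (x 0)) (x 2)
      have hIm := hl' (F.eval (x 1)) (B.eval (x 0)) (x 2)
      have hq := (((hl ((derivative B).eval (x 0)) ((derivative F).eval (x 1)) (x 2)).fun_mul hRe).fun_sub
        ((hl ((derivative A).eval (x 0)) ((derivative E).eval (x 1)) (x 2)).fun_mul hIm)).fun_div
        ((hRe.fun_pow 2).fun_add (hIm.fun_pow 2)) (hNne x hx)
      refine (((hl _ _ (x 2)).fun_sub hq).const_mul γ).congr_deriv ?_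
      simp only [Nat.cast_ofNat, Nat.reduceSub, pow_one]
      ring
    · show HasDerivAt (fun s : ℝ => G1 (Function.update x 0 s)) (D1 x) (x 0)
      simp only [hG1, hD1, Function.update_self, Function.update_of_ne h10.1, Function.update_of_ne h10.2]
      refine (((((B.hasDerivAt _).mul_const _).fun_sub ((A.hasDerivAt _).mul_const _)).const_mul γ).fun_div
        (((((A.hasDerivAt _).const_mul _).const_add _).fun_pow 2).fun_add
          ((((B.hasDerivAt _).const_mul _).const_add _).fun_pow 2)) (hNne x hx)).congr_deriv ?_
      simp only [Nat.cast_ofNat, Nat.reduceSub, pow_one]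
      ring
    · show HasDerivAt (fun s : ℝ => G1 (Function.update x 1 s)) (D2 x) (x 1)
      simp only [hG1, hD2, Function.update_self, Function.update_of_ne h01.1, Function.update_of_ne h01.2]
      refine (((((E.hasDerivAt _).const_mul _).fun_sub ((F.hasDerivAt _).const_mul _)).const_mul γ).fun_div
        (((((E.hasDerivAt _).const_mul _).add_const _).fun_pow 2).fun_add
          ((((F.hasDerivAt _).const_mul _).add_const _).fun_pow 2)) (hNne x hx)).congr_deriv ?_
      simp only [Nat.cast_ofNat, Nat.reduceSub, pow_one]
      ring
  -- the three closed-cube representations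
  let r : Fin 3 → IntegralRep 4 := fun j =>
    { domain := S
      integrand := I j
      isSemialgebraic_domain := hSsa
      isSemialgebraicFunOn_integrand := (hIsc j).1
      integrableOn := (hIsc j).2.integrableOn_compact hSc }
  refine ⟨G, D, r, fun j => ⟨(hGsc j).1, hDsa j, angTrSC_bound (hGsc j) hSc, hGfib j, hGder j⟩,
    ?_, fun x _ => ?_⟩
  · -- the integrand clauses
    intro j
    fin_cases j <;> refine ⟨rfl, fun x _ => ?_⟩
    · show D0 x = D0 x - (G0 (Function.update x 2 1) - G0 (Function.update x 2 0))
      rw [hG0_one, hG0_zero, sub_zero, sub_zero]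
    · rfl
    · rfl
  · -- `Σ integrands = γ (ω_P − ω_Q) − leftovers`: `D₀ + D₁ + D₂ = γ (ω_P − ω_Q)` by construction
    rw [Fin.sum_univ_three]
    show D0 x + (D1 x - (G1 (Function.update x 0 1) - G1 (Function.update x 0 0))) +
      (D2 x - (G1 (Function.update x 1 1) - G1 (Function.update x 1 0))) = _
    simp only [hD0, hG1, Function.update_self, Function.update_of_ne h10.1, Function.update_of_ne h10.2,
      Function.update_of_ne h01.1, Function.update_of_ne h01.2]
    ring

end Summit.KontsevichZagierPeriods.KontsevichZagierPeriods.Cruxes.StokesGeneration.FibrewiseStokes
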